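import Summits.ResolutionOfSingularities.ResolutionOfSingularities.Theorems.DeltaCutStellarHypShape

/-!
# StellarCut T11 — «HypPersist»: the TAME HYPERSURFACE SHAPE SURVIVES A FACE ROUND, stalk by stalk
# (the principal-generator half of the hypersurface round lemma; lens-6, g33; 0-weight)

Fix a `ncHypShape n`-datum `M` for `(E, H)` with `HasSNC (H :: boundaryOf E)` (`DeltaCutStellarHypShape`, T10) and a blow-up
`π : X' → X` of a FACE `C = Σ_{K ∈ T} K` THROUGH `H` (`H ∈ T ⊆ H :: boundaryOf E`) of weight `Σ_T aⱼ ≥ n` (`IsBlowup π C`,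
universal property).  Write `H'` for the strict transform of `H`, `E' := transformExp E π T n` (old divisors transformed with
their labels, then the exceptional divisor `F` labelled `Σ_T aⱼ − n`), `M' := M.transform π C` (tree / BGMW controlled transform).

* `ncHypShape.exists_generator_transform` — AT EVERY POINT `x' ∈ V(H')` (closed or not, ANY residue field) the stalk of `M'.ideal`
  is again `(h'ⁿ + u'·m')` with `u'` a unit, `(h') = H'_{x'}`, `(m') = 𝓜(E')_{x'}`.  PROOF (uniform, no charts): in the domain
  `𝒪_{X',x'}` (regular: the new frame is s.n.c., T4 `hasSNC_ncShape_transform`) let `(ε) = F_{x'}`; Literature's divisor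
  identities
  `π^*(h) = (h')(ε)` (`map_stalkIdeal_eq_mul_of_mem`) and `π^*𝓜(E) = (ε)^{Σ_T a}·𝓜(E↦E')` (`comap_monomialIdeal`, on `(H,0) :: E`)
  give `π^*h = h'·ε`, `π^*m = εⁿ·m'·v` (units absorbed into the generators), so `π^*(hⁿ + u m) = εⁿ·(h'ⁿ + (π^*u·v)·m')`, and the
  controlled transform's stalk `(π^*𝓘 : (ε)ⁿ)` (`IsBlowup.stalkIdeal_controlledTransform`, Atiyah–Macdonald 3.15) is
  `(h'ⁿ + u'·m')` (`colon_span_pow_mul`).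
* `ncHypShape.transform_of_support_subset` — hence `M'` is a `ncHypShape n`-datum for `(E', H')` AS SOON AS `supp M' ⊆ V(H')`:
  the marking and the stalk units `n` persist (`transform_mult`, local ring maps), and the label clause persists because a strict
  transform is neither another divisor's strict transform nor the exceptional divisor (`eq_of_strictTransformIdeal_eq`,
  `strictTransformIdeal_ne_comap`).  The remaining clause `supp M' ⊆ V(H')` — the TAME GUARD — is `DeltaCutStellarHypFibre` (T12,
  over the centre, where `¬ p ∣ n` bites) together with `mem_support_strictTransformIdeal_of_not_mem` below (off the centre).

TAME desk inhabitant: `x³ + (1 + xz)·z³w³`, characteristic `2`, `n = 3` (T8).  0 sorry; axioms standard. [new] [folklore]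
[cite: Kollar2007, (3.111) Step 3] [cite: BierstoneGrigorievMilmanWlodarczyk2011, §3.2 Lemma 3.2.1 and §4 Step 2b]
[cite: AtiyahMacdonald1969, Cor. 3.15]
-/

noncomputable section

open CategoryTheory CategoryTheory.Limits AlgebraicGeometry TopologicalSpace IsLocalRing
open Literature.AlgebraicGeometry.Resolution

namespace Summit.ResolutionOfSingularities.ResolutionOfSingularities.Theorems.DeltaCutClasses

open Summit.ResolutionOfSingularities.ResolutionOfSingularities.Theorems
open WeakOrderReduction ForcedTowerClasses

/-! ### §Local — the colon of a principal ideal by a power of a nonzero element, in a domain -/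

section LocalAlgebra

variable {S : Type*} [CommRing S] [IsDomain S]

/-- **`((εⁿ·g) : (ε)ⁿ) = (g)` in a domain with `ε ≠ 0`.** [cite: AtiyahMacdonald1969, Cor. 3.15] -/
theorem colon_span_pow_mul {ε : S} (hε : ε ≠ 0) (g : S) (n : ℕ) :
    (Ideal.span {ε ^ n * g}).colon (Ideal.span {ε} ^ n : Ideal S) = Ideal.span {g} := by
  ext r
  rw [Ideal.span_singleton_pow, Ideal.mem_colon_span_singleton, Ideal.mem_span_singleton, Ideal.mem_span_singleton]
  constructor
  · rintro ⟨t, ht⟩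
    exact ⟨t, mul_right_cancel₀ (pow_ne_zero n hε) (by rw [ht]; ring)⟩
  · rintro ⟨t, rfl⟩
    exact ⟨t, by ring⟩

omit [IsDomain S] in
/-- the image of `hⁿ + u·m` under a ring map with `φ h = h'·ε` and `φ m = εⁿ·m'·v` is `εⁿ·(h'ⁿ + (φ u·v)·m')`. [folklore] -/
theorem map_pow_add_mul_eq {R : Type*} [CommRing R] (φ : R →+* S) {h m : R} (u : R) {h' ε m' v : S} {n : ℕ}
    (ha : φ h = h' * ε) (hb : φ m = ε ^ n * m' * v) :
    φ (h ^ n + u * m) = ε ^ n * (h' ^ n + (φ u * v) * m') := by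
  rw [map_add, map_pow, map_mul, ha, hb]; ring

end LocalAlgebra

/-! ### §Generators — principal stalk generators under `HasSNC` -/

section Generators

variable {X : Scheme.{0}}

/-- under `HasSNC Es`, the stalk of a member `K ∈ Es` at ANY point is principal with a NONZERO generator (a member of a regular
system of parameters at points of `V(K)`, `1` elsewhere). [folklore] -/
theorem exists_ne_zero_stalkIdeal_eq_span {Es : List X.IdealSheafData} (hEs : HasSNC Es) {K : X.IdealSheafData} (hK : K ∈ Es)
    (x : X) : ∃ ε : X.presheaf.stalk x, ε ≠ 0 ∧ stalkIdeal K x = Ideal.span {ε} := by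
  obtain ⟨d, z, hz, ι, -, hι⟩ := exists_isRsopPart_labels_of_hasSNC hEs x
  by_cases hx : x ∈ K.support
  · exact ⟨z (ι ⟨K, hK, hx⟩), hz.ne_zero _, hι ⟨K, hK, hx⟩⟩
  · exact ⟨1, one_ne_zero, by rw [stalkIdeal_eq_top_of_not_mem_support hx, Ideal.span_singleton_one]⟩

/-- under `HasSNC (boundaryOf E)`, the stalk of the monomial ideal `𝓜(E)` at any point is principal.
[cite: BierstoneGrigorievMilmanWlodarczyk2011, §4 Step 2b] -/
theorem exists_stalkIdeal_monomialIdeal_eq_span {E : List (X.IdealSheafData × ℕ)} (hE : HasSNC (boundaryOf E)) (x : X) :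
    ∃ m : X.presheaf.stalk x, stalkIdeal (monomialIdeal E) x = Ideal.span {m} := by
  haveI := (hE x).1
  obtain ⟨g, hg, -, -⟩ := exists_generator_stalkIdeal_monomialIdeal E (x := x)
    (fun p hp hxp => hE.exists_generator_of_mem (fst_mem_boundaryOf hp) hxp)
  exact ⟨g, hg⟩

end Generators

/-! ### §Round — the stalks of the transform along `V(H')` -/

section Round

variable {X X' : Scheme.{0}} [IsLocallyNoetherian X] {π : X' ⟶ X} {H : X.IdealSheafData}
  {E : List (X.IdealSheafData × ℕ)} {T : Finset X.IdealSheafData} {n : ℕ} {M : MarkedIdeal X}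

omit [IsLocallyNoetherian X] in
/-- the exceptional divisor is a member of the new frame `H' :: boundaryOf E'`. [folklore] -/
theorem comap_mem_frame_transform (m : ℕ) :
    (T.sup id).comap π ∈ strictTransformIdeal π (T.sup id) H :: boundaryOf (transformExp E π T m) := by
  refine List.mem_cons_of_mem _ ?_
  rw [boundaryOf_transformExp]
  exact List.mem_append_right _ (List.mem_singleton_self _)

/-- **THE HYPERSURFACE ROUND LEMMA, GENERATOR HALF — at EVERY point of `V(H')`.**  For a `ncHypShape n`-datum and the blow-up of
a face through `H` of weight `≥ n`, at every `x' ∈ V(H')` the stalk of the transformed ideal is `(h'ⁿ + u'·m')` with `u'` a unit,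
`(h') = H'_{x'}`, `(m') = 𝓜(transformExp E π T n)_{x'}` (module docstring for the proof; no residue-field hypothesis).
[new] [cite: Kollar2007, (3.111) Step 3] [cite: BierstoneGrigorievMilmanWlodarczyk2011, §3.2 Lemma 3.2.1] -/
theorem ncHypShape.exists_generator_transform (hEs : HasSNC (H :: boundaryOf E)) (hT : ∀ K ∈ T, K ∈ H :: boundaryOf E)
    (hHT : H ∈ T) (hπ : IsBlowup π (T.sup id)) (hmT : n ≤ weightOf E T) (hP : ncHypShape n X E H M) {x' : X'}
    (hx' : x' ∈ (strictTransformIdeal π (T.sup id) H).support) :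
    ∃ h' m' u' : X'.presheaf.stalk x', IsUnit u' ∧
      stalkIdeal (strictTransformIdeal π (T.sup id) H) x' = Ideal.span {h'} ∧
      stalkIdeal (monomialIdeal (transformExp E π T n)) x' = Ideal.span {m'} ∧
      stalkIdeal (M.transform π (T.sup id)).ideal x' = Ideal.span {h' ^ n + u' * m'} := by
  classical
  haveI : IsProper π := hπ.isProper
  haveI : IsLocallyNoetherian X' := LocallyOfFiniteType.isLocallyNoetherian π
  have hEs' : HasSNC (strictTransformIdeal π (T.sup id) H :: boundaryOf (transformExp E π T n)) :=
    hasSNC_ncShape_transform hEs hT hπ n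
  haveI : IsRegularLocalRing (X'.presheaf.stalk x') := (hEs' x').1
  haveI : IsDomain (X'.presheaf.stalk x') := isDomain_of_isRegularLocalRing _
  have hy : π x' ∈ H.support := mem_support_of_mem_support_strictTransformIdeal hx'
  obtain ⟨h, m, u, hu, hHx, hMx, hIx⟩ := hP.exists_generator hy
  -- principal generators upstairs: `h₀'` of `H'`, `ε ≠ 0` of the exceptional divisor, `m'` of `𝓜(E')`
  obtain ⟨h₀, -, hH₀⟩ := exists_ne_zero_stalkIdeal_eq_span hEs' List.mem_cons_self x'
  obtain ⟨ε, hε0, hε⟩ := exists_ne_zero_stalkIdeal_eq_span hEs' (comap_mem_frame_transform n) x'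
  obtain ⟨m', hm'⟩ := exists_stalkIdeal_monomialIdeal_eq_span (hasSNC_boundaryOf_of_cons hEs') x'
  set φ := (π.stalkMap x').hom with hφ
  -- (a) `π^*(h) = (h₀')(ε)`
  have ha : Ideal.span {h₀ * ε} = Ideal.span {φ h} := by
    have := map_stalkIdeal_eq_mul_of_mem hEs hT hπ hHT x'
    rw [hHx, Ideal.map_span, Set.image_singleton, hH₀, hε, Ideal.span_singleton_mul_span_singleton] at this
    exact this.symm
  obtain ⟨v₁, hv₁⟩ := Ideal.span_singleton_eq_span_singleton.mp ha
  -- (b) `π^*(m) = (ε)ⁿ (m')`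
  have hb : Ideal.span {ε ^ n * m'} = Ideal.span {φ m} := by
    have hE₀ : HasSNC (boundaryOf ((H, 0) :: E)) := hEs
    have hT₀ : ∀ K ∈ T, K ∈ boundaryOf ((H, 0) :: E) := hT
    have hst := congrArg (fun J => stalkIdeal J x') (comap_monomialIdeal hE₀ hT₀ hπ)
    simp only [List.map_cons] at hst
    rw [stalkIdeal_comap_eq_map_stalkMap, monomialIdeal_cons_zero, hMx, Ideal.map_span, Set.image_singleton,
      stalkIdeal_mul, stalkIdeal_pow, hε, weightOf_cons_zero, monomialIdeal_cons_zero, Ideal.span_singleton_pow] at hst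
    have hm₂ : Ideal.span {m'} = stalkIdeal (monomialIdeal
        (E.map fun p => (strictTransformIdeal π (T.sup id) p.1, p.2))) x' * Ideal.span {ε ^ (weightOf E T - n)} := by
      rw [← hm', transformExp, monomialIdeal_append, monomialIdeal_singleton, stalkIdeal_mul, stalkIdeal_pow, hε,
        Ideal.span_singleton_pow]
    rw [← hφ] at hst
    rw [hst, mul_comm (ε ^ n) m', ← Ideal.span_singleton_mul_span_singleton, hm₂, mul_assoc,
      Ideal.span_singleton_mul_span_singleton, ← pow_add, Nat.sub_add_cancel hmT, mul_comm]
  obtain ⟨v₂, hv₂⟩ := Ideal.span_singleton_eq_span_singleton.mp hb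
  -- (c) the controlled transform: `𝓘'_{x'} = (π^*(hⁿ + u m) : (ε)ⁿ) = (h'ⁿ + u' m')` with `h' := h₀' v₁`, `u' := π^*u · v₂`
  refine ⟨h₀ * ↑v₁, m', φ u * ↑v₂, (hu.map φ).mul v₂.isUnit, ?_, hm', ?_⟩
  · rw [hH₀, Ideal.span_singleton_mul_right_unit v₁.isUnit]
  · rw [MarkedIdeal.transform_ideal, hP.mult_eq, hπ.stalkIdeal_controlledTransform, stalkIdeal_comap_eq_map_stalkMap,
      hIx, Ideal.map_span, Set.image_singleton, hε, ← hφ,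
      map_pow_add_mul_eq φ u (h' := h₀ * ↑v₁) (ε := ε) (m' := m') (v := ↑v₂) (by rw [← hv₁]; ring) (by rw [← hv₂]),
      colon_span_pow_mul hε0]

omit [IsLocallyNoetherian X] in
/-- **OFF THE CENTRE, `V(H)` LIFTS TO `V(H')`**: at a point `x'` with `π x' ∉ V(C)` and `π x' ∈ V(H)` one has `x' ∈ V(H')`
(the strict transform's stalk is the pulled-back stalk, and stalk maps are local). [folklore] -/
theorem mem_support_strictTransformIdeal_of_not_mem [IsLocallyNoetherian X'] {C : X.IdealSheafData} {x' : X'}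
    (hxC : π x' ∉ C.support) (hy : π x' ∈ H.support) : x' ∈ (strictTransformIdeal π C H).support := by
  rw [mem_support_iff_stalkIdeal_le, stalkIdeal_strictTransformIdeal_of_not_mem_support C H hxC]
  exact (Ideal.map_mono ((mem_support_iff_stalkIdeal_le H _).mp hy)).trans (IsLocalRing.map_maximalIdeal_le _)

/-- **THE TAME HYPERSURFACE SHAPE SURVIVES A FACE ROUND, given the guard `supp M' ⊆ V(H')`.**  Marking, stalk units `n`, the
label clause and the principal presentation along `V(H')` all persist (module docstring); the support clause is the hypothesis.
[new] [cite: Kollar2007, (3.111) Step 3] -/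
theorem ncHypShape.transform_of_support_subset (hEs : HasSNC (H :: boundaryOf E)) (hT : ∀ K ∈ T, K ∈ H :: boundaryOf E)
    (hHT : H ∈ T) (hπ : IsBlowup π (T.sup id)) (hmT : n ≤ weightOf E T) (hP : ncHypShape n X E H M)
    (hSupp : (M.transform π (T.sup id)).support ⊆ ((strictTransformIdeal π (T.sup id) H).support : Set X')) :
    ncHypShape n X' (transformExp E π T n) (strictTransformIdeal π (T.sup id) H) (M.transform π (T.sup id)) := by
  haveI : IsProper π := hπ.isProper
  haveI : IsLocallyNoetherian X' := LocallyOfFiniteType.isLocallyNoetherian π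
  refine ⟨by rw [MarkedIdeal.transform_mult, hP.mult_eq], fun x' => ?_, ?_,
    fun x' hx' => hP.exists_generator_transform hEs hT hHT hπ hmT hx', hSupp⟩
  · -- `n` stays a unit: stalk maps are ring maps
    simpa only [map_natCast] using (hP.isUnit_natCast (π x')).map (π.stalkMap x').hom
  · -- the label clause
    intro q hq hqH
    by_cases hV : ((strictTransformIdeal π (T.sup id) H).support : Set X') = ∅
    · exact Or.inr hV
    · refine Or.inl ?_
      obtain ⟨x', hx'⟩ := Set.nonempty_iff_ne_empty.mpr hV
      have hx'' : x' ∈ (strictTransformIdeal π (T.sup id) H).support := hx'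
      rw [transformExp, List.mem_append, List.mem_map, List.mem_singleton] at hq
      rcases hq with ⟨p, hp, rfl⟩ | rfl
      · have hpE : p.1 ∈ H :: boundaryOf E := List.mem_cons_of_mem _ (fst_mem_boundaryOf hp)
        have heq : H = p.1 := eq_of_strictTransformIdeal_eq hEs hT hπ List.mem_cons_self hpE hx'' hqH.symm
        have hy : π x' ∈ H.support := mem_support_of_mem_support_strictTransformIdeal hx''
        exact (hP.label_eq_zero hp heq.symm).resolve_right (Set.nonempty_iff_ne_empty.mp ⟨π x', hy⟩)
      · exfalso
        have hqH' : (T.sup id).comap π = strictTransformIdeal π (T.sup id) H := hqH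
        have hxF : x' ∈ ((T.sup id).comap π).support := by rw [hqH']; exact hx''
        exact strictTransformIdeal_ne_comap hEs hT hπ List.mem_cons_self hxF hqH'.symm

end Round

end Summit.ResolutionOfSingularities.ResolutionOfSingularities.Theorems.DeltaCutClasses
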